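import Summits.ValiantsHypothesis.ValiantsHypothesis.Theses.ValuativeGCT
import Summits.ValiantsHypothesis.ValiantsHypothesis.Theorems.ValuativeGCTValuativeBound
import Summits.ValiantsHypothesis.ValiantsHypothesis.Theorems.ValuativeGCTNoValuativeFlipBeyondGrenet
import Summits.ValiantsHypothesis.ValiantsHypothesis.Theorems.ValuativeGCTValuativeFlipTailSuffices
import Summits.ValiantsHypothesis.ValiantsHypothesis.Theorems.ValuativeGCTValuativeFlipIntegralCutNormalization
import Summits.ValiantsHypothesis.ValiantsHypothesis.Theorems.ValuativeGCTValuativeFlipFirstRungKroneckerGap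
import Summits.ValiantsHypothesis.ValiantsHypothesis.Theorems.ValuativeGCTValuativeFlipIdealBodyBound
import Summits.ValiantsHypothesis.ValiantsHypothesis.Theorems.ValuativeGCTValuativeFlipInnerMonotone
import Summits.ValiantsHypothesis.ValiantsHypothesis.Theorems.TailFlip.Negative.TailFlipLoadBearing
import Summits.ValiantsHypothesis.ValiantsHypothesis.Theorems.TailFlip.Negative.TailFlipKillTransfer

/-!
# Strategist gen-1 sketch — crux stmt-ValiantsHypothesis-15687 `ValuativeGCT.TailFlip` (WALL-BREAKER census)

Typed forms of the statements discussed in `Cruxes/TailFlip/STRATEGY-CENSUS.md` (this seat,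
planner-cstrat-stmt-ValiantsHypothesis-15687-p1-0, 2026-08-17).  Nothing here is registered as a
line or an item; the file certifies that the census's candidate statements elaborate over existing
declarations, records `#check`s of the landed theorems the census leans on, and proves ONE small
necessary condition (`innerGrowth_of_flipAt`, negation heading).
-/

set_option linter.dupNamespace false

namespace Summit.ValiantsHypothesis.ValiantsHypothesis.Cruxes.TailFlip.StrategistGen1

open Literature.NumberTheory.DiophantineGeometry Literature.Computability.AlgebraicComplexity
open Literature.Computability.Complexity
open Summit.ValiantsHypothesis.ValiantsHypothesis.Theses.ValuativeGCT
open Summit.ValiantsHypothesis.ValiantsHypothesis.Theorems.ValuativeFlip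
open Summit.ValiantsHypothesis.ValiantsHypothesis.Theorems.TailFlip.Negative
open Summit.ValiantsHypothesis.ValiantsHypothesis.Theorems.NoValuativeFlip
open Summit.ValiantsHypothesis.ValiantsHypothesis.Theorems.ValuativeBound

/-! ## Landed theorems the census leans on (names must resolve) -/
#check @tailFlip_iff_valuativeFlip            -- TailFlip ↔ ValuativeFlip (p117805)
#check @valuativeFlip_iff_polyPadded          -- only m ≥ n^k matters
#check @valuativeFlip_iff_longShapes          -- witnesses of length > k at m ≥ n^(k+2)
#check @tailFlip_iff                           -- TailFlip = ∀ slope, ∀ c, ev. n, ∀ tail m, FlipAt n m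
#check @dcPerSuperpolynomial_of_tailFlip       -- TailFlip ⇒ summit (dc form)
#check @not_tailFlip_of_noValuativeFlip        -- kill statement transfers
#check @ValuativeBound_proof                   -- K_m ≤ dim T_U
#check @icut_finrank_le_finrank_truncation_of_isIntegral   -- K̃_m (normalisation) ≤ dim T_U, every centre
#check @exists_orbitMultiplicity_det_lt_census -- K_m < sk somewhere in degree 2, every m ≥ 3
#check @plethysmCoeff_lt_of_flip               -- a flip has its per side within p_{>m}(λ̄) of the plethysm
#check @orbitMultiplicity_paddedPer_le_det_of_two_pow_le  -- Grenet: P(n',m,·) ≤ K_m for 2^n' ≤ m+1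
#check @orbitMultiplicity_paddedPer_mono_inner  -- P(n,m,·) ≤ P(n',m,·) for n ≤ n'

/-- The window top `M_c(n) = 2^((log₂ n + c)^c)` (reducible, so that `NeZero (windowTop n c)` is
found through `NeZero.pow`). -/
abbrev windowTop (n c : ℕ) : ℕ := 2 ^ ((Nat.log 2 n + c) ^ c)

example (n c : ℕ) : NeZero (windowTop n c) := inferInstance

/-- The no-cut census space `T_⊥(λ)` at level `m`, degree `δ`, shape `λ` (the crux's `T` with the
valuative factor dropped = `Stab(det_m)`-invariant `B`-semi-invariants of weight `λ*`; its dimension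
is the symmetric Kronecker count `sk(λ; δ^m)`, tree `stabInv_eq_explicit`). -/
noncomputable def census (m δ : ℕ) (lam : Nat.Partition (m * δ)) :
    Submodule ℂ (MvPolynomial (MatIdx m × MatIdx m) ℂ) :=
  MvPolynomial.homogeneousSubmodule (MatIdx m × MatIdx m) ℂ (m * δ) ⊓
    (⨅ (M : Matrix (MatIdx m) (MatIdx m) ℂ)
      (_ : linSubst (MatIdx m) ℂ M (detFormLex ℂ m) = detFormLex ℂ m),
      LinearMap.ker ((MvPolynomial.aeval fun p : MatIdx m × MatIdx m =>
          ∑ l : MatIdx m, M l p.2 •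
            (MvPolynomial.X (p.1, l) : MvPolynomial (MatIdx m × MatIdx m) ℂ)).toLinearMap -
        (LinearMap.id : MvPolynomial (MatIdx m × MatIdx m) ℂ →ₗ[ℂ] MvPolynomial (MatIdx m × MatIdx m) ℂ))) ⊓
    (⨅ (g : Matrix.GeneralLinearGroup (MatIdx m) ℂ) (_ : IsUpperTriangular g),
      LinearMap.ker ((MvPolynomial.aeval fun p : MatIdx m × MatIdx m =>
          ∑ l : MatIdx m, ((g⁻¹ : Matrix.GeneralLinearGroup (MatIdx m) ℂ) :
            Matrix (MatIdx m) (MatIdx m) ℂ) p.1 l •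
              (MvPolynomial.X (l, p.2) : MvPolynomial (MatIdx m × MatIdx m) ℂ)).toLinearMap -
        weightChar (partitionWeightLex m lam) g •
          (LinearMap.id : MvPolynomial (MatIdx m × MatIdx m) ℂ →ₗ[ℂ] MvPolynomial (MatIdx m × MatIdx m) ℂ)))

/-- The crux's flip body with an extra ADMISSIBILITY predicate on the centre `(U, r)` (the body of
`FlipAt` verbatim otherwise).  Used to type the strengthenings by centre class. -/
def FlipVia (n m : ℕ) [NeZero m] (adm : Submodule ℂ (MatIdx m → ℂ) → ℕ → Prop) : Prop :=
  ∃ (U : Submodule ℂ (MatIdx m → ℂ)) (r δ : ℕ) (lam : Nat.Partition (m * δ)),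
    (∀ u ∈ U, (Matrix.of fun a b : Fin m => u (toLex (a, b))).rank ≤ r) ∧ adm U r ∧
    lam.parts.card ≤ m * m ∧
    (let χ : Weight (MatIdx m) := (Weight.dualOfPartition (m * m) lam).toMatIdx
     let T : Submodule ℂ (MvPolynomial (MatIdx m × MatIdx m) ℂ) :=
       MvPolynomial.homogeneousSubmodule (MatIdx m × MatIdx m) ℂ (m * δ) ⊓
         ((MvPolynomial.vanishingIdeal ℂ
             {p : MatIdx m × MatIdx m → ℂ | ∀ j : MatIdx m, (fun i => p (j, i)) ∈ U}) ^ (δ * (m - r))).restrictScalars ℂ ⊓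
         (⨅ (M : Matrix (MatIdx m) (MatIdx m) ℂ)
           (_ : linSubst (MatIdx m) ℂ M (detFormLex ℂ m) = detFormLex ℂ m),
           LinearMap.ker ((MvPolynomial.aeval (R := ℂ) fun p : MatIdx m × MatIdx m =>
               ∑ l : MatIdx m, M l p.2 • MvPolynomial.X (p.1, l)).toLinearMap -
             LinearMap.id (R := ℂ) (M := MvPolynomial (MatIdx m × MatIdx m) ℂ))) ⊓
         (⨅ (g : Matrix.GeneralLinearGroup (MatIdx m) ℂ) (_ : IsUpperTriangular g),
           LinearMap.ker ((MvPolynomial.aeval (R := ℂ) fun p : MatIdx m × MatIdx m =>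
               ∑ l : MatIdx m, ((g⁻¹ : Matrix.GeneralLinearGroup (MatIdx m) ℂ) :
                 Matrix (MatIdx m) (MatIdx m) ℂ) p.1 l • MvPolynomial.X (l, p.2)).toLinearMap -
             weightChar χ g • LinearMap.id (R := ℂ) (M := MvPolynomial (MatIdx m × MatIdx m) ℂ)))
     Module.finrank ℂ ↥T < orbitMultiplicity ℂ (paddedPerFormLex ℂ n m) m χ)

/-- Sanity: with the trivial admissibility predicate `FlipVia` is the disprover's `FlipAt`. -/
theorem flipVia_true_iff (n m : ℕ) [NeZero m] : FlipVia n m (fun _ _ => True) ↔ FlipAt n m := by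
  constructor
  · rintro ⟨U, r, δ, lam, hU, -, hcard, h⟩
    exact ⟨U, r, δ, lam, hU, hcard, h⟩
  · rintro ⟨U, r, δ, lam, hU, hcard, h⟩
    exact ⟨U, r, δ, lam, hU, trivial, hcard, h⟩

/-- A flip through an admissible class is a flip. -/
theorem flipAt_of_flipVia {n m : ℕ} [NeZero m] {adm : Submodule ℂ (MatIdx m → ℂ) → ℕ → Prop}
    (h : FlipVia n m adm) : FlipAt n m := by
  obtain ⟨U, r, δ, lam, hU, -, hcard, h⟩ := h
  exact ⟨U, r, δ, lam, hU, hcard, h⟩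

/-! ## §Strengthen — typed candidates -/

/-- **S-1 `DeepGapTailFlip`** (strengthening by centre class): the tail flips through centres whose
Edmonds gap `m − r` is at least a THIRD of the size (e.g. `Λ₃^{⊕k} ⊕ D`, `k = ⌊m/3⌋`; Derksen–Makam
spaces reach gaps `< m/2`, the ceiling by `ncrk ≤ 2·rk`).  The valuative threshold is then
`δ(m − r) ≥ mδ/3`, a positive FRACTION of the degree instead of the skew centre's `δ`.  Implies the
crux (`tailFlip_of_deepGapTailFlip`).  Census verdict (§3 S-1): no leverage — the deep condition only
constrains the near-Levi components of an invariant (off-block-diagonal factors supply order for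
free), on the Levi-diagonal component it is a SUM condition over the skew blocks, its overall size is
the jet-rank question of the dead parent line `skew-restriction-rank` with another centre, and no
single-centre cut can go below the normalisation count `K̃_m` (`icut_finrank_le_finrank_truncation`),
after which the residual is the classical multiplicity-obstruction problem against `Nor Δ(det_m)`. -/
def DeepGapTailFlip : Prop :=
  ∀ a b : ℕ, b < a → ∀ c : ℕ, ∃ n₀ : ℕ, ∀ n ≥ n₀, ∀ (m : ℕ) [NeZero m], a * n < b * m →
    m ≤ windowTop n c → FlipVia n m (fun _ r => m ≤ 3 * (m - r))

/-- **S-2 `KroneckerSparsePerPositive`** (the one loophole in the `U = ⊥` death, typed as the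
object a Kronecker-majorant line would have to exhibit): at the window top, for every `c ≥ 2`,
eventually in `n`, some Kadish–Landsberg shape with a WIDE body (`b > M_c(n)`, forced by
`kronecker_ray_const_from_body`) has a rectangular Kronecker coefficient POLYNOMIAL in the body size
while the padded permanent still occurs there.  With `PerCeilingPoly` (parent census N-C 1) this is
NECESSARY for any symmetric-Kronecker (`U = ⊥`) flip at the top; tensor-square ubiquity (Saxl-type)
and Bürgisser–Christandl–Ikenmeyer rectangle positivity predict it is FALSE; no candidate family is
known.  Refuting it retires every `U = ⊥` line of this crux rigorously. -/
def KroneckerSparsePerPositive : Prop :=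
  ∀ c : ℕ, 2 ≤ c → ∃ D n₀ : ℕ, ∀ n ≥ n₀,
    ∃ (δ : ℕ) (lam : Nat.Partition (windowTop n c * δ)),
      lam.parts.card ≤ n * n + 1 ∧ windowTop n c < bodySize lam ∧
      kroneckerCoeff ℂ lam (Nat.Partition.rectangle (windowTop n c) δ)
          (Nat.Partition.rectangle (windowTop n c) δ) ≤ (bodySize lam + 1) ^ D ∧
      0 < orbitMultiplicity ℂ (paddedPerFormLex ℂ n (windowTop n c)) (windowTop n c)
            (partitionWeightLex (windowTop n c) lam)

/-! ## §Transfer — typed candidate (Dörfler–Ikenmeyer–Panova 2019 analogue) -/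

/-- **T-1 `PerTypeGenericFlip`** (DIP19, SIAGA 4 (2020) Thm 1, transplanted: "container
stabiliser-poor, small variety type-generic"): at every tail position some admissible shape has
(i) the padded permanent TYPE-GENERIC — its multiplicity equals the ambient plethysm coefficient
`a_λ(δ[m])` (DIP19 Prop. 4 for power sums) — and (ii) the determinant STABILISER-POOR there —
`sk(λ; δ^m) = dim census < a_λ(δ[m])` (such shapes exist: IP17 arXiv:1512.03798 after Thm 4,
`λ = (13,13,2,2,2,2,2)`, `d = 12`, `n = 3`; they need `δ > m/n`, IP17 Cor. 6).  It implies the crux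
with `U = ⊥` (`orbitMultiplicity_le_plethysmCoeff_holds` is the reverse inequality of (i)).  Break
point recorded in the census: (i) fails on every shape with `≥ 4` rows once `R₄(per_n)` is a proper
subvariety of quaternary `n`-ics (`n ≥ 25`), and `≤ 3` rows never flip (Dickson). -/
def PerTypeGenericFlip : Prop :=
  ∀ c : ℕ, ∃ n₀ : ℕ, ∀ n ≥ n₀, ∀ (m : ℕ) [NeZero m], n ^ 2 ≤ m → m ≤ windowTop n c →
    ∃ (δ : ℕ) (lam : Nat.Partition (m * δ)), lam.parts.card ≤ m * m ∧
      plethysmCoeff ℂ (MatIdx m) m (partitionWeightLex m lam) ≤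
        orbitMultiplicity ℂ (paddedPerFormLex ℂ n m) m (partitionWeightLex m lam) ∧
      Module.finrank ℂ ↥(census m δ lam) < plethysmCoeff ℂ (MatIdx m) m (partitionWeightLex m lam)

/-! ## §Decomposition — the typed split and its crux-strength half -/

/-- **D-1a `FacetPerFloor F`** (per half of the only honest split, on the NAMED family of
Kadish–Landsberg FACET shapes `λ₁ = δ(m − n)` with an explicit floor `F`): eventually, at every tail
position, some facet shape has padded-permanent multiplicity at least `F n m δ`. -/
def FacetPerFloor (F : ℕ → ℕ → ℕ → ℕ) : Prop :=
  ∀ c : ℕ, ∃ n₀ : ℕ, ∀ n ≥ n₀, ∀ (m : ℕ) [NeZero m], n ^ 2 ≤ m → m ≤ windowTop n c →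
    ∃ (δ : ℕ) (lam : Nat.Partition (m * δ)), lam.parts.card ≤ n * n + 1 ∧
      lam.parts.sup = δ * (m - n) ∧
      F n m δ ≤ orbitMultiplicity ℂ (paddedPerFormLex ℂ n m) m (partitionWeightLex m lam)

/-- **D-1b `FacetDetCensus F`** (det half: on EVERY facet shape of the tail the no-cut census — or a
cut — is below the same floor).  For any honest `F` this half is the whole difficulty (a det-side
upper bound at super-polynomial level on shapes of unbounded length) and, for the no-cut census, is
predicted false by the parent census §2 T-B; an `F` quantified existentially across the two halves
is costume.  Not filed. -/
def FacetDetCensus (F : ℕ → ℕ → ℕ → ℕ) : Prop :=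
  ∀ c : ℕ, ∃ n₀ : ℕ, ∀ n ≥ n₀, ∀ (m : ℕ) [NeZero m], n ^ 2 ≤ m → m ≤ windowTop n c →
    ∀ (δ : ℕ) (lam : Nat.Partition (m * δ)), lam.parts.card ≤ n * n + 1 →
      lam.parts.sup = δ * (m - n) → Module.finrank ℂ ↥(census m δ lam) < F n m δ

/-! ## §Negation — a provable necessary condition on witnesses -/

/-- **N-1 (inner growth is necessary).**  A flip at `(n, m)` exhibits a weight at which the padded
permanent of inner size `n` has STRICTLY larger multiplicity than the padded permanent of any inner
size `n'` with `2^{n'} ≤ m + 1` (Grenet puts the latter inside `Δ(det_m)`, so its multiplicity is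
below `K_m ≤ dim T_U`).  In the tail `m ≤ 2^((log₂ n + c)^c)` this applies to every
`n' ≤ (log₂ n + c)^c − 1 < n`: a witness must separate `per_n` from `per_{polylog n}` at level `m`
by multiplicity — vacuous exactly when `ℓ(λ) > n'² + 1` (Kadish–Landsberg at inner size `n'`). -/
theorem innerGrowth_of_flipAt {n n' m : ℕ} [NeZero m] (hn' : 2 ^ n' ≤ m + 1) (h : FlipAt n m) :
    ∃ (δ : ℕ) (lam : Nat.Partition (m * δ)), lam.parts.card ≤ m * m ∧
      orbitMultiplicity ℂ (paddedPerFormLex ℂ n' m) m (partitionWeightLex m lam) <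
        orbitMultiplicity ℂ (paddedPerFormLex ℂ n m) m (partitionWeightLex m lam) := by
  obtain ⟨U, r, δ, lam, hU, hcard, hflip⟩ := h
  refine ⟨δ, lam, hcard, ?_⟩
  have h1 := noValuativeFlip_body_of_two_pow_le ValuativeBound_proof m hn' U r hU δ lam hcard
  exact lt_of_le_of_lt h1 hflip

/-- **N-1′ (the same, with the witness length pinned below the inner Kadish–Landsberg bound made
explicit as a hypothesis-free corollary):** if moreover `n' ≤ n ≤ m`, the two multiplicities are
ordered the other way weakly (`orbitMultiplicity_paddedPer_mono_inner`), so the flip forces a STRICT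
inner growth step between `n'` and `n`. Recorded as the conjunction. -/
theorem innerGrowth_strict_of_flipAt {n n' m : ℕ} [NeZero m] (hn' : 2 ^ n' ≤ m + 1)
    (hle : n' ≤ n) (hnm : n ≤ m) (h : FlipAt n m) :
    ∃ (δ : ℕ) (lam : Nat.Partition (m * δ)), lam.parts.card ≤ m * m ∧
      orbitMultiplicity ℂ (paddedPerFormLex ℂ n' m) m (partitionWeightLex m lam) ≤
        orbitMultiplicity ℂ (paddedPerFormLex ℂ n m) m (partitionWeightLex m lam) ∧
      orbitMultiplicity ℂ (paddedPerFormLex ℂ n' m) m (partitionWeightLex m lam) <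
        orbitMultiplicity ℂ (paddedPerFormLex ℂ n m) m (partitionWeightLex m lam) := by
  obtain ⟨δ, lam, hcard, hlt⟩ := innerGrowth_of_flipAt (n := n) hn' h
  exact ⟨δ, lam, hcard, orbitMultiplicity_paddedPer_mono_inner hle hnm _, hlt⟩

/-! ## Trivial relations recorded for the census -/

/-- The crux is its own parent (landed). -/
example : TailFlip ↔ ValuativeFlip := tailFlip_iff_valuativeFlip

/-- Proving the crux proves Valiant's hypothesis in dc form (landed). -/
example (h : TailFlip) : Literature.Computability.AlgebraicComplexity.DcPerSuperpolynomial ℂ :=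
  dcPerSuperpolynomial_of_tailFlip h

/-- A deep-gap tail flip is in particular the crux (through `tailFlip_iff`). -/
theorem tailFlip_of_deepGapTailFlip (h : DeepGapTailFlip) : TailFlip := by
  rw [tailFlip_iff]
  intro a b hba c
  obtain ⟨n₀, hn₀⟩ := h a b hba c
  refine ⟨n₀, fun n hn m _ hslope htop => ?_⟩
  exact flipAt_of_flipVia (hn₀ n hn m hslope htop)

end Summit.ValiantsHypothesis.ValiantsHypothesis.Cruxes.TailFlip.StrategistGen1
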